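import Mathlib.Analysis.InnerProductSpace.Orthonormal
import Mathlib.Analysis.InnerProductSpace.PiL2
import Mathlib.LinearAlgebra.FiniteDimensional.Basic
import Mathlib.LinearAlgebra.Dimension.Constructions
import Mathlib.Algebra.Order.Chebyshev
import Mathlib.Algebra.Order.BigOperators.Ring.Finset
import HarnessLib

/-!
# CLUSTER INDUCTION, part 1 — the FRAME LEMMA for a nearly orthonormal family inside the span of an orthonormal family of the same size
# (F4 of `R6-DESIGN.md` for S-PSCAL″ of crux `DressedRitz`, stmt-QuantumFields-20205; LEAD prover ym-lead-20205-polyakovlift g2)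

Pure linear algebra in a real inner product space `E`.  `e : ι → E` orthonormal (`ι` finite, `n = |ι|`), `u : ι → E` with every `u_l ∈ span e` and Gram matrix
`|⟪u_l, u_m⟫ − δ_{lm}| ≤ ρ`, `nρ ≤ 1/2`.  Then `u` is a basis of `span e` and a FRAME with lower bound `1/2`:
`‖w‖² ≤ 2 Σ_l ⟪w, u_l⟫²` for every `w ∈ span e`; consequently for every `x ∈ E` the mass of `x` on `span e` satisfies
`Σ_m ⟪x, e_m⟫² ≤ 2 Σ_l ⟪x, u_l⟫²` (★ `mass_le_two_mul_sum_inner_sq`).  Use (part 2): `e` = exact eigenvectors of a spectral cluster, `u_l` = the in-cluster parts of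
transplanted quasimodes; a vector nearly orthogonal to every quasimode has small mass on the cluster.

HONEST FRAMING: linear algebra; nothing here bears on infinite volume, the continuum limit or the Clay gap.
References: Reed–Simon IV, Thm. XIII.1 [cite: ReedSimonIV1978, Thm. XIII.1].
-/

set_option autoImplicit false

noncomputable section

open Finset Submodule Module
open scoped BigOperators RealInnerProductSpace

namespace Summit.QuantumFields.YangMills.Theorems.FemtoTransferGap.ClusterInd

variable {E : Type*} [NormedAddCommGroup E] [InnerProductSpace ℝ E]
variable {ι : Type*} [Fintype ι]

/-- Norm square of a finite linear combination: `‖Σ β_l u_l‖² = Σ_l Σ_m β_l β_m ⟪u_l, u_m⟫`. [folklore] -/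
theorem norm_sq_sum_smul (u : ι → E) (β : ι → ℝ) :
    ‖∑ l, β l • u l‖ ^ 2 = ∑ l, ∑ m, β l * β m * ⟪u l, u m⟫ := by
  rw [← real_inner_self_eq_norm_sq, sum_inner]
  refine sum_congr rfl fun l _ => ?_
  rw [inner_sum]
  refine sum_congr rfl fun m _ => ?_
  rw [real_inner_smul_left, real_inner_smul_right]; ring

variable [DecidableEq ι]

/-- ★ **Gershgorin-type lower bound**: `|⟪u_l,u_m⟫ − δ_{lm}| ≤ ρ` ⟹ `(1 − nρ)·Σ β_l² ≤ ‖Σ β_l u_l‖²`. [folklore] -/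
theorem gram_lower (u : ι → E) {ρ : ℝ} (hρ : 0 ≤ ρ) (hG : ∀ l m, |⟪u l, u m⟫ - if l = m then 1 else 0| ≤ ρ) (β : ι → ℝ) :
    (1 - Fintype.card ι * ρ) * ∑ l, β l ^ 2 ≤ ‖∑ l, β l • u l‖ ^ 2 := by
  rw [norm_sq_sum_smul]
  -- Σ_{l,m} β_l β_m ⟪u_l,u_m⟫ ≥ Σ_{l,m} β_lβ_m δ_{lm} − ρ Σ_{l,m}|β_l||β_m|
  have hterm : ∀ l m, β l * β m * (if l = m then (1:ℝ) else 0) - ρ * (|β l| * |β m|) ≤ β l * β m * ⟪u l, u m⟫ := by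
    intro l m
    have h := abs_le.1 (hG l m)
    have hbb : |β l * β m| = |β l| * |β m| := abs_mul _ _
    have : β l * β m * ⟪u l, u m⟫ - β l * β m * (if l = m then (1:ℝ) else 0) = β l * β m * (⟪u l, u m⟫ - if l = m then 1 else 0) := by ring
    have habs : |β l * β m * (⟪u l, u m⟫ - if l = m then 1 else 0)| ≤ |β l| * |β m| * ρ := by
      rw [abs_mul, hbb]; exact mul_le_mul_of_nonneg_left (hG l m) (by positivity)
    nlinarith [abs_le.1 habs, this]
  have hsum : ∑ l, ∑ m, (β l * β m * (if l = m then (1:ℝ) else 0) - ρ * (|β l| * |β m|)) ≤ ∑ l, ∑ m, β l * β m * ⟪u l, u m⟫ :=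
    sum_le_sum fun l _ => sum_le_sum fun m _ => hterm l m
  have hdiag : ∑ l, ∑ m, β l * β m * (if l = m then (1:ℝ) else 0) = ∑ l, β l ^ 2 := by
    refine sum_congr rfl fun l _ => ?_
    simp only [mul_ite, mul_one, mul_zero, Finset.sum_ite_eq, Finset.mem_univ, if_true, sq]
  have habs : ∑ l, ∑ m, ρ * (|β l| * |β m|) = ρ * (∑ l, |β l|) ^ 2 := by
    rw [sq, sum_mul_sum, mul_sum]
    refine sum_congr rfl fun l _ => ?_
    rw [mul_sum]
  have hcs : (∑ l, |β l|) ^ 2 ≤ Fintype.card ι * ∑ l, β l ^ 2 := by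
    have := sq_sum_le_card_mul_sum_sq (s := (univ : Finset ι)) (f := fun l => |β l|)
    simp only [Finset.card_univ, sq_abs] at this
    exact this
  have hsplit : ∑ l, ∑ m, (β l * β m * (if l = m then (1:ℝ) else 0) - ρ * (|β l| * |β m|)) =
      ∑ l, β l ^ 2 - ρ * (∑ l, |β l|) ^ 2 := by
    rw [← hdiag, ← habs, ← sum_sub_distrib]
    refine sum_congr rfl fun l _ => ?_
    rw [sum_sub_distrib]
  rw [hsplit] at hsum
  nlinarith [hsum, mul_le_mul_of_nonneg_left hcs hρ]

/-- The near-orthonormal family is linearly independent (`nρ < 1`). [folklore] -/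
theorem linearIndependent_of_gram (u : ι → E) {ρ : ℝ} (hρ : 0 ≤ ρ) (hG : ∀ l m, |⟪u l, u m⟫ - if l = m then 1 else 0| ≤ ρ)
    (hn : Fintype.card ι * ρ < 1) : LinearIndependent ℝ u := by
  rw [Fintype.linearIndependent_iff]
  intro β hβ l
  have h := gram_lower u hρ hG β
  rw [hβ, norm_zero] at h
  have hpos : 0 < 1 - Fintype.card ι * ρ := by linarith
  have hsum0 : ∑ m, β m ^ 2 ≤ 0 := by nlinarith [sum_nonneg fun m (_ : m ∈ (univ : Finset ι)) => sq_nonneg (β m)]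
  have := (sum_eq_zero_iff_of_nonneg fun m _ => sq_nonneg (β m)).1 (le_antisymm hsum0 (sum_nonneg fun m _ => sq_nonneg (β m))) l (mem_univ l)
  exact pow_eq_zero_iff (n := 2) two_ne_zero |>.1 this

/-- The near-orthonormal family spans the span of the orthonormal family it lives in (same finite index type). [folklore] -/
theorem span_eq_of_gram (e u : ι → E) (he : Orthonormal ℝ e) (hu : ∀ l, u l ∈ span ℝ (Set.range e)) {ρ : ℝ} (hρ : 0 ≤ ρ)
    (hG : ∀ l m, |⟪u l, u m⟫ - if l = m then 1 else 0| ≤ ρ) (hn : Fintype.card ι * ρ < 1) :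
    span ℝ (Set.range u) = span ℝ (Set.range e) := by
  have hle : span ℝ (Set.range u) ≤ span ℝ (Set.range e) := span_le.2 (by rintro _ ⟨l, rfl⟩; exact hu l)
  haveI : FiniteDimensional ℝ (span ℝ (Set.range e)) := FiniteDimensional.span_of_finite ℝ (Set.finite_range e)
  refine Submodule.eq_of_le_of_finrank_eq hle ?_
  rw [finrank_span_eq_card (linearIndependent_of_gram u hρ hG hn), finrank_span_eq_card he.linearIndependent]

/-- ★ **Frame lower bound**: for `w ∈ span e`, `‖w‖² ≤ 2·Σ_l ⟪w, u_l⟫²` (`nρ ≤ 1/2`). [cite: ReedSimonIV1978, Thm. XIII.1] -/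
theorem norm_sq_le_two_mul_sum_inner_sq (e u : ι → E) (he : Orthonormal ℝ e) (hu : ∀ l, u l ∈ span ℝ (Set.range e)) {ρ : ℝ} (hρ : 0 ≤ ρ)
    (hG : ∀ l m, |⟪u l, u m⟫ - if l = m then 1 else 0| ≤ ρ) (hn : Fintype.card ι * ρ ≤ 1 / 2) {w : E} (hw : w ∈ span ℝ (Set.range e)) :
    ‖w‖ ^ 2 ≤ 2 * ∑ l, ⟪w, u l⟫ ^ 2 := by
  have hn1 : Fintype.card ι * ρ < 1 := by linarith
  rw [← span_eq_of_gram e u he hu hρ hG hn1] at hw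
  obtain ⟨β, hβ⟩ := (Submodule.mem_span_range_iff_exists_fun ℝ).1 hw
  -- ‖w‖² = Σ β_l ⟪w, u_l⟫
  have h1 : ‖w‖ ^ 2 = ∑ l, β l * ⟪w, u l⟫ := by
    rw [← real_inner_self_eq_norm_sq]
    conv_lhs => rw [← hβ]
    rw [sum_inner]
    refine sum_congr rfl fun l _ => ?_
    rw [real_inner_smul_left, hβ, real_inner_comm]
  -- Σβ² ≤ 2‖w‖²
  have h2 : ∑ l, β l ^ 2 ≤ 2 * ‖w‖ ^ 2 := by
    have h := gram_lower u hρ hG β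
    rw [hβ] at h
    nlinarith [h, sum_nonneg fun l (_ : l ∈ (univ : Finset ι)) => sq_nonneg (β l), sq_nonneg ‖w‖]
  -- Cauchy–Schwarz
  have h3 : (∑ l, β l * ⟪w, u l⟫) ^ 2 ≤ (∑ l, β l ^ 2) * ∑ l, ⟪w, u l⟫ ^ 2 := sum_mul_sq_le_sq_mul_sq _ _ _
  have hS0 : 0 ≤ ∑ l, ⟪w, u l⟫ ^ 2 := sum_nonneg fun l _ => sq_nonneg _
  rw [← h1] at h3
  -- ‖w‖⁴ ≤ 2‖w‖² S ⇒ ‖w‖² ≤ 2S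
  by_cases hw0 : ‖w‖ ^ 2 = 0
  · rw [hw0]; positivity
  · have hwpos : 0 < ‖w‖ ^ 2 := lt_of_le_of_ne (sq_nonneg _) (Ne.symm hw0)
    have : (‖w‖ ^ 2) * ‖w‖ ^ 2 ≤ (2 * ∑ l, ⟪w, u l⟫ ^ 2) * ‖w‖ ^ 2 := by nlinarith [h3, h2, hS0]
    exact le_of_mul_le_mul_right this hwpos

/-- ★★ **Mass on a cluster through a frame**: for every `x ∈ E`, `Σ_m ⟪x, e_m⟫² ≤ 2·Σ_l ⟪x, u_l⟫²`. [cite: ReedSimonIV1978, Thm. XIII.1] -/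
theorem mass_le_two_mul_sum_inner_sq (e u : ι → E) (he : Orthonormal ℝ e) (hu : ∀ l, u l ∈ span ℝ (Set.range e)) {ρ : ℝ} (hρ : 0 ≤ ρ)
    (hG : ∀ l m, |⟪u l, u m⟫ - if l = m then 1 else 0| ≤ ρ) (hn : Fintype.card ι * ρ ≤ 1 / 2) (x : E) :
    ∑ m, ⟪x, e m⟫ ^ 2 ≤ 2 * ∑ l, ⟪x, u l⟫ ^ 2 := by
  -- the projection `w = Σ ⟪x,e_m⟫ e_m`
  set w : E := ∑ m, ⟪x, e m⟫ • e m with hw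
  have hwmem : w ∈ span ℝ (Set.range e) := sum_mem fun m _ => smul_mem _ _ (subset_span ⟨m, rfl⟩)
  have hwe : ∀ m, ⟪w, e m⟫ = ⟪x, e m⟫ := fun m => by
    rw [hw, sum_inner]
    simp only [real_inner_smul_left, orthonormal_iff_ite.1 he, mul_ite, mul_one, mul_zero, Finset.sum_ite_eq', Finset.mem_univ, if_true]
  have hnorm : ‖w‖ ^ 2 = ∑ m, ⟪x, e m⟫ ^ 2 := by
    rw [← real_inner_self_eq_norm_sq]
    conv_lhs => rw [hw]
    rw [inner_sum]
    refine sum_congr rfl fun m _ => ?_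
    rw [real_inner_smul_right, ← hw, hwe m, sq]
  -- `⟪w, u_l⟫ = ⟪x, u_l⟫` since `u_l ∈ span e` and `w − x ⊥ e_m`
  have hwu : ∀ l, ⟪w, u l⟫ = ⟪x, u l⟫ := by
    intro l
    obtain ⟨γ, hγ⟩ := (Submodule.mem_span_range_iff_exists_fun ℝ).1 (hu l)
    rw [← hγ, inner_sum, inner_sum]
    refine sum_congr rfl fun m _ => ?_
    rw [real_inner_smul_right, real_inner_smul_right, hwe m]
  have h := norm_sq_le_two_mul_sum_inner_sq e u he hu hρ hG hn hwmem
  rw [hnorm] at h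
  simpa only [hwu] using h

end Summit.QuantumFields.YangMills.Theorems.FemtoTransferGap.ClusterInd

end
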